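import Summits.ValiantsHypothesis.ValiantsHypothesis.Theorems.KPlusLogSqLawTropicalBTowerLogOfNewtonTau
import Summits.ValiantsHypothesis.ValiantsHypothesis.Theses.KPlusLogSqLaw

/-!
# Route «KPlusLogSqLaw», crux `TropicalB` (stmt-ValiantsHypothesis-19771) — under the weak Newton-polygon τ-conjecture the crux
# SHRINKS to the thin strip `⌊log₂ m⌋ + 1 < K < ⌊√m⌋·(⌊log₂ m⌋ + 1)`

HONEST FRAMING.  Def-free helper (`--supports stmt-ValiantsHypothesis-19771`), sequel of `…TropicalBTowerLogOfNewtonTau`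
(`fatStrip_of_newtonTauWeak`, `fatStrip_of_separatingShadowCeiling`).  Nothing here asserts `TropicalB`, the conjectures
`SeparatingShadowCeiling` / `KPTT.newtonTauWeak`, or anything on VP ≠ VNP: the theorems are implications.

* `tropKPlusLogSqLaw_of_fatStrip_of_thinStrip` — glue: the off-window theorem `TropicalCensus.tropRootLawAt_offWindow`
  (`K ≤ ⌊log₂ m⌋ + 1`, constant 3) + a fat-strip law `⌊√m⌋(⌊log₂ m⌋+1) ≤ K → T ≤ 2^{C₁K}` + a thin-strip law
  `⌊log₂ m⌋+1 < K < ⌊√m⌋(⌊log₂ m⌋+1) → T ≤ 2^{C₂(K+⌊log₂ m⌋²)}` give `TropKPlusLogSqLaw` with `C = C₁ + C₂ + 3`;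
* `tropicalB_iff_thinStrip_of_separatingShadowCeiling` / `…_of_newtonTauWeak` — **under `SeparatingShadowCeiling` (hence under
  `KPTT.newtonTauWeak`) the crux `TropicalB` (δ-equal to `TropKPlusLogSqLaw`) is EQUIVALENT to its restriction to the thin strip
  `⌊log₂ m⌋ + 1 < K < ⌊√m⌋(⌊log₂ m⌋+1)`** — the registered fat stub `stub_tropFat` (`⌊log₂ m⌋² ≤ K`) is then needed only for
  `⌊log₂ m⌋² ≤ K < ⌊√m⌋(⌊log₂ m⌋+1)`, and the whole tower column `m ≤ K²/(⌊log₂ m⌋+1)²` (in particular `stub_tropTowerLog`,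
  `…TowerLogOfNewtonTau`) is conditionally settled.  The square tower `m = K²` (`stub_squareTower`) is NOT reached (the ceiling gives
  `2^{O(K log K)}` there).
[folklore] glue.
-/

set_option linter.dupNamespace false
set_option autoImplicit false

namespace Summit.ValiantsHypothesis.ValiantsHypothesis.Theorems.KPlusLogSqLaw.ShadowCeilingBridge

open Summit.ValiantsHypothesis.ValiantsHypothesis.Theorems.MatrixDescartes.Negative
open Summit.ValiantsHypothesis.ValiantsHypothesis.Theorems.LacunarySymmetroidMatrixDescartes.TropicalCensus
open Summit.ValiantsHypothesis.ValiantsHypothesis.Theorems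
open Literature.Computability.AlgebraicComplexity
open Finset

/-- **Glue**: off-window theorem + fat-strip law + thin-strip law ⇒ `TropKPlusLogSqLaw` (constant `C₁ + C₂ + 3`). [folklore] -/
theorem tropKPlusLogSqLaw_of_fatStrip_of_thinStrip (C₁ C₂ : ℕ)
    (hfat : ∀ m K : ℕ, Nat.sqrt m * (Nat.log 2 m + 1) ≤ K → TropRootLawAt m K (2 ^ (C₁ * K)))
    (hthin : ∀ m K : ℕ, Nat.log 2 m + 1 < K → K < Nat.sqrt m * (Nat.log 2 m + 1) →
      TropRootLawAt m K (2 ^ (C₂ * (K + Nat.log 2 m ^ 2)))) :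
    TropKPlusLogSqLaw := by
  refine ⟨C₁ + C₂ + 3, fun m K => ?_⟩
  by_cases h1 : K ≤ Nat.log 2 m + 1
  · refine tropRootLawAt_mono (Nat.pow_le_pow_right (by norm_num) ?_) (tropRootLawAt_offWindow m K (Or.inl h1))
    exact Nat.mul_le_mul_right _ (by omega)
  · by_cases h2 : Nat.sqrt m * (Nat.log 2 m + 1) ≤ K
    · refine tropRootLawAt_mono (Nat.pow_le_pow_right (by norm_num) ?_) (hfat m K h2)
      calc C₁ * K ≤ C₁ * (K + Nat.log 2 m ^ 2) := Nat.mul_le_mul_left _ (by omega)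
        _ ≤ (C₁ + C₂ + 3) * (K + Nat.log 2 m ^ 2) := Nat.mul_le_mul_right _ (by omega)
    · refine tropRootLawAt_mono (Nat.pow_le_pow_right (by norm_num) ?_) (hthin m K (by omega) (by omega))
      exact Nat.mul_le_mul_right _ (by omega)

/-- **Under the separating-shadow ceiling, `TropicalB` ⟺ its thin-strip restriction** `⌊log₂ m⌋+1 < K < ⌊√m⌋(⌊log₂ m⌋+1)`.
[folklore] -/
theorem tropicalB_iff_thinStrip_of_separatingShadowCeiling (h : SeparatingShadowCeiling) :
    Summit.ValiantsHypothesis.ValiantsHypothesis.Theses.KPlusLogSqLaw.TropicalB ↔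
      ∃ C : ℕ, ∀ m K : ℕ, Nat.log 2 m + 1 < K → K < Nat.sqrt m * (Nat.log 2 m + 1) →
        TropRootLawAt m K (2 ^ (C * (K + Nat.log 2 m ^ 2))) := by
  constructor
  · rintro ⟨C, hC⟩
    exact ⟨C, fun m K _ _ => hC m K⟩
  · rintro ⟨C₂, h₂⟩
    obtain ⟨C₁, h₁⟩ := fatStrip_of_separatingShadowCeiling h
    exact tropKPlusLogSqLaw_of_fatStrip_of_thinStrip C₁ C₂ h₁ h₂

/-- **Under the weak Newton-polygon τ-conjecture, `TropicalB` ⟺ its thin-strip restriction** `⌊log₂ m⌋+1 < K < ⌊√m⌋(⌊log₂ m⌋+1)`: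
the crux's open window shrinks from `⌊log₂ m⌋+1 < K < m` to `⌊log₂ m⌋+1 < K < ⌊√m⌋(⌊log₂ m⌋+1)` conditionally on
`KPTT.newtonTauWeak`. [folklore] -/
theorem tropicalB_iff_thinStrip_of_newtonTauWeak (h : KPTT.newtonTauWeak) :
    Summit.ValiantsHypothesis.ValiantsHypothesis.Theses.KPlusLogSqLaw.TropicalB ↔
      ∃ C : ℕ, ∀ m K : ℕ, Nat.log 2 m + 1 < K → K < Nat.sqrt m * (Nat.log 2 m + 1) →
        TropRootLawAt m K (2 ^ (C * (K + Nat.log 2 m ^ 2))) :=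
  tropicalB_iff_thinStrip_of_separatingShadowCeiling (separatingShadowCeiling_of_newtonTauWeak h)

end Summit.ValiantsHypothesis.ValiantsHypothesis.Theorems.KPlusLogSqLaw.ShadowCeilingBridge
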